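import Summits.QuantumFields.BalabanUV.Beta.GAN24.StripLegVectors
import Summits.QuantumFields.BalabanUV.Beta.GAN24.KFibClosedBridge
import Summits.QuantumFields.BalabanUV.Beta.GAN24.ArrowNorms
import Summits.QuantumFields.BalabanUV.Beta.GAN24.ArrowOperator

/-!
# `BalabanUV.Beta.GAN24.StripLegReadout` — binder row G-an2-4 / (CONV-C), road P1-fibre, row **P1-L10** `FibreStrip` ((I3′)), cut «(M4) scaled alias-space
# Neumann, two anchors» (`HOME/b2b-balaban-gan24-formalise-leaf-16/L10-CUT-M4.md`), module **F8 part 2**: THE LEG READOUT — `kFibW` at a COMPLEX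
# momentum as a pairing ⟨reading vector, arrow solution of the source vector⟩, and its bound as a FUNCTION of the scaled a-priori bound of F7

NOT IN PRINT; OUR PROOF ATTEMPT (of the road; THIS file is [folklore] linear algebra + bookkeeping over `ℂ`).  HONEST FRAMING (cell contract, verbatim):
«discharging `BetaPertH` makes Bałaban's UV stability UNCONDITIONAL — a real constructive-QFT result; it is NOT the continuum limit and NOT the Clay
problem.»  HONEST DEPENDENCY (verbatim): «continuum YM on T⁴ ⇐ BetaPertH ∧ nine spine estimates (0/9 proved); BetaPertH ⇐ (D1) ∧ (D4) ∧ CAP+tail;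
G-an2-4 gates asym, D1 and NE2/3/4.»  No cited fact, no wall binder, no `def … : Prop` fact (the a-priori bound of F7 is an explicit `∀`-hypothesis);
nothing of the K-slot of (CONV-C) is discharged here.  NOT summit progress.

## What is proved (generic `d`, `D = d+1`; block side `N`, decimation side `M`, units `sf sm`, every COMPLEX `p` unless stated)
* §1 READOUT IDENTITIES (no invertibility needed — `Matrix.inv` is total): with `v := (fibreMatrix (blochChar p))⁻¹ *ᵥ legSrcVec …` (`solVec`),
  `kFibW … (inl κ) x′ b y′ p = Σ_m sf·readW_T00(m, κ, x′)·ampA p v m κ` (field leg: leaf-05's `kFibW_eq_readout`/`readout_inl`, leaf-16's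
  `boxData_inl_eq_sum`, leaf-05's bridge `legCoef_inl_mul_readW`) and `kFibW … (inr κ) x′ b y′ p = sm·cphase(quo N (M•x′)) p·v (inr (inr κ))`.
* §2 THE ARROW EQUATION OF THE LEG SOURCE: if the arrow matrix at `p` satisfies a scaled a-priori bound then `fibreFun (blochChar p) v = legSrcVec`
  (det ≠ 0 by leaf-16's `det_trigPolySymbol_ne_zero_of_arrow`), hence `∃ c, arrowMat (aliasArrow N p) *ᵥ pack (ampA p v, ampμ p v, v_φ, c) =
  packSrc p legSrcVec` (leaf-16's `fibreFun_eq_iff_arrowMat`), and `packSrc` of a field / multiplier leg source is `pack (sf • fhatF) 0 0 0` /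
  `pack 0 0 (unit Q-vector) 0` (leaf-05's `srcEL_legSrcVec_inl` …, bridge `fieldLegSrc_eq_smul_fhatF`).
* §3 SCALED DUALITY: the weighted Cauchy–Schwarz inequality `‖Σ w·x‖² ≤ (Σ (σ‖w‖)²)·(Σ (‖x‖/σ)²)` and the conversion of an operator-norm bound
  `‖(D_ρ 𝔸 D_σ)⁻¹‖ ≤ A` (F7's currency, `ArrowNorms`) into the squared a-priori form `Σ (‖x‖/σ)² ≤ A²·Σ (ρ‖𝔸x‖)²` used below.
* §4 THE FOUR LEG BOUNDS as functions of the a-priori constant `A`, of slot-weight bounds `σ ≤ 1` (A-slots), `σ ≤ Sφ` (φ-slots), `|ρ| ≤ R0 / RE`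
  (EL rows on / off the zero alias), `|ρ| ≤ RQ` (Q rows), and of part 1's strip sums (`|Im p_i| ≤ η ≤ 1/4`, `|Re p_i| ≤ π`, `0 < M ≤ N`):
  ff `≤ A·sf²·e(x′)e(y′)·6^{D+1}(N/M)^{2D}·N^{−D}·√(5^D(R0² + RE²(5^D−1)))`, fm `≤ A·sf·sm·e(x′)·cφ(y′)·√(6^{D+1}(N/M)^{2D}5^D)·RQ`,
  mf `≤ A·sm·sf·Sφ·cφ(x′)·e(y′)·√(6^{D+1}(N/M)^{2D}(R0²+RE²(5^D−1)))·N^{−D}`, mm `≤ A·sm²·Sφ·RQ·cφ(x′)cφ(y′)` (growth factors `e(ρ) = exp(ηΣ|ρ_i|)`,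
  `cφ(ρ) = ‖cphase (∓quo N (M•ρ)) p‖`, both `= 1`-ish at box representatives — part 3 / F9).
In the cut's scaling (`Sφ = r₀²/N³`, `R0 = N²/r₀²`, `RE = N²/π²`, `RQ = N^{−(D+1)}`) and units (`sf = M`, `sm = M^D`, `N = Lc·M`) all four are
`N`-FREE at `D = 4` (R3 of the cut: only the PRODUCTS are) — the arithmetic is part 3 (`StripLegUnits`, with F1c's `ArrowScaling`).
Unit `b2b-balaban-gan24-p1` (row G-an2-4 owner, gen 2), 2026-08-20.
-/

noncomputable section

open Complex Finset Matrix
open scoped BigOperators Real Matrix.Norms.L2Operator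
open Literature.Probability.LatticeModels (TorusSite Torus.proj)
open Literature.MathematicalPhysics.QuantumFieldTheory
open Literature.MathematicalPhysics.QuantumFieldTheory.LatticeForm (quo repZ)
open Literature.MathematicalPhysics.QuantumFieldTheory.Balaban1983to89
open Literature.MathematicalPhysics.QuantumFieldTheory.Balaban1983to89.Beta
open AffineAveraging (Site)
open BlochFibreMatrix (Idx blochChar fibreFun fibreMatrix fibreMatrix_mulVec stencil pieceMatrix fibreMatrix_blochChar_eq_trigPolySymbol)
open FibreInverseDecay (cphase trigPolySymbol)
open OneStepResolventKernel (Fib)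
open OneStepKernelFamily (legSet legPt legW)
open Summit.QuantumFields.BalabanUV.Beta.HessKerDressedUnits (legScale)
open Summit.QuantumFields.BalabanUV.Beta.GAN24.AliasWeights (wMaj)
open Summit.QuantumFields.BalabanUV.Beta.GAN24.FibreDFTDictionary (ampA ampμ boxData_inl_eq_sum)
open Summit.QuantumFields.BalabanUV.Beta.GAN24.CombesThomasFibreStep (kFibW)
open Summit.QuantumFields.BalabanUV.Beta.GAN24.AliasObjects (fhatF)
open Summit.QuantumFields.BalabanUV.Beta.GAN24.KFibLegSource
  (legSrcVec fieldLegSrc srcEL_legSrcVec_inl srcG_legSrcVec_inl legSrcVec_inl_M legSrcVec_inl_Q srcEL_legSrcVec_inr srcG_legSrcVec_inr legSrcVec_inr_M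
   legSrcVec_inr_Q)
open Summit.QuantumFields.BalabanUV.Beta.GAN24.KFibClosedForm (legCoef kFibW_eq_readout readout_inl)
open Summit.QuantumFields.BalabanUV.Beta.GAN24.KFibClosedBridge (legCoef_inl_mul_readW fieldLegSrc_eq_smul_fhatF)
open Summit.QuantumFields.BalabanUV.Beta.GAN24.ArrowOperator
  (AIdx Loc arrowMat aliasArrow pack packSrc fibreFun_eq_iff_arrowMat det_trigPolySymbol_ne_zero_of_arrow)
open Summit.QuantumFields.BalabanUV.Beta.GAN24.ArrowNorms (norm_toLp_mulVec_le)
open Summit.QuantumFields.BalabanUV.Beta.GAN24.StripLegVectors (sum_norm_readW_sq_le_strip sum_weighted_norm_srcW_sq_le_strip)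

namespace Summit.QuantumFields.BalabanUV.Beta.GAN24.StripLegReadout

variable {d N : ℕ} [NeZero N]

/-! ## §1 The readout identities at every complex momentum -/

/-- [folklore] THE SOLUTION VECTOR of the fibre system with the `b`-leg source (total `Matrix.inv`; it IS the solution wherever `det ≠ 0`). -/
def solVec (N : ℕ) [NeZero N] (M : ℕ) (p : Fin (d + 1) → ℂ) (C : ℂ) (b : Fib d) (y' : Site (d + 1)) : Idx (d + 1) N → ℂ :=
  (fibreMatrix (N := N) (⇑(blochChar p)))⁻¹ *ᵥ legSrcVec N M p C b y'

/-- [folklore] **FIELD-LEG READOUT IN ALIAS COORDINATES**: `kFibW … (inl κ) x′ b y′ p = Σ_m sf · readW_T00 N M p m κ x′ · ampA p v m κ`, `v = solVec`. -/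
theorem kFibW_inl_eq (M : ℕ) (sf sm : ℝ) (κ : Fin (d + 1)) (x' : Site (d + 1)) (b : Fib d) (y' : Site (d + 1)) (p : Fin (d + 1) → ℂ) :
    kFibW N M sf sm (Sum.inl κ) x' b y' p =
      ∑ m : TorusSite (d + 1) N, ((sf : ℂ) * AliasObjects.readW N M p m κ x') * ampA p (solVec N M p (legCoef M sf sm b) b y') m κ := by
  rw [kFibW_eq_readout]
  have h := readout_inl (N := N) M p (legCoef M sf sm (Sum.inl κ : Fib d)) κ x' (solVec N M p (legCoef M sf sm b) b y')
    (fun m κ' => ampA p (solVec N M p (legCoef M sf sm b) b y') m κ') (fun z => boxData_inl_eq_sum p _ κ z)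
  unfold solVec at h ⊢
  rw [h]
  exact Finset.sum_congr rfl fun m _ => by rw [← legCoef_inl_mul_readW]

/-- [folklore] **MULTIPLIER-LEG READOUT**: `kFibW … (inr κ) x′ b y′ p = sm · cphase (quo N (M•x′)) p · v (inr (inr κ))`, `v = solVec`. -/
theorem kFibW_inr_eq (M : ℕ) (sf sm : ℝ) (κ : Fin (d + 1)) (x' : Site (d + 1)) (b : Fib d) (y' : Site (d + 1)) (p : Fin (d + 1) → ℂ) :
    kFibW N M sf sm (Sum.inr κ) x' b y' p =
      (sm : ℂ) * cphase (quo N ((M : ℤ) • x')) p * solVec N M p (legCoef M sf sm b) b y' (Sum.inr (Sum.inr κ)) := by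
  rw [kFibW_eq_readout]
  unfold solVec
  simp [legSet, legPt, CombesThomasFibre.legIdx, legCoef, legScale, legW]

/-! ## §2 The arrow equation of the leg source -/

section Arrow

variable (p : Fin (d + 1) → ℂ)

/-- [folklore] If the arrow matrix at `p` has trivial kernel, the solution vector solves the fibre system: `fibreFun (blochChar p) (solVec …) = legSrcVec …`. -/
theorem fibreFun_solVec (hinj : ∀ x, arrowMat (aliasArrow N p) *ᵥ x = 0 → x = 0) (M : ℕ) (C : ℂ) (b : Fib d) (y' : Site (d + 1)) :
    fibreFun (⇑(blochChar p)) (solVec N M p C b y') = legSrcVec N M p C b y' := by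
  have hdet : IsUnit (fibreMatrix (N := N) (⇑(blochChar p))).det := by
    rw [fibreMatrix_blochChar_eq_trigPolySymbol]
    exact isUnit_iff_ne_zero.2 (det_trigPolySymbol_ne_zero_of_arrow p hinj)
  unfold solVec
  rw [← fibreMatrix_mulVec, Matrix.mulVec_mulVec, Matrix.mul_nonsing_inv _ hdet, Matrix.one_mulVec]

/-- [folklore] **THE ARROW EQUATION**: for some gauge constant `c`, the packed amplitudes of `solVec` solve the arrow system with sources `packSrc p legSrcVec`. -/
theorem exists_arrow_eq (hinj : ∀ x, arrowMat (aliasArrow N p) *ᵥ x = 0 → x = 0) (M : ℕ) (C : ℂ) (b : Fib d) (y' : Site (d + 1)) :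
    ∃ c : ℂ, arrowMat (aliasArrow N p) *ᵥ
        pack (ampA p (solVec N M p C b y')) (ampμ p (solVec N M p C b y')) (fun κ => solVec N M p C b y' (Sum.inr (Sum.inr κ))) c =
      packSrc p (legSrcVec N M p C b y') :=
  (fibreFun_eq_iff_arrowMat p _ _).1 (fibreFun_solVec p hinj M C b y')

/-- [folklore] The packed source of a FIELD leg: `packSrc p (legSrcVec … (inl l) …) = pack (fieldLegSrc …) 0 0 0`. -/
theorem packSrc_legSrcVec_inl (M : ℕ) (C : ℂ) (l : Fin (d + 1)) (y' : Site (d + 1)) :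
    packSrc p (legSrcVec N M p C (Sum.inl l) y') = pack (fieldLegSrc N M p C l y') 0 0 0 := by
  unfold packSrc
  rw [srcEL_legSrcVec_inl, srcG_legSrcVec_inl, legSrcVec_inl_M, legSrcVec_inl_Q]

/-- [folklore] The packed source of a MULTIPLIER leg: `packSrc p (legSrcVec … (inr l) …) = pack 0 0 (C·cphase(−quo N (M•y′)) p • e_l) 0`. -/
theorem packSrc_legSrcVec_inr (M : ℕ) (C : ℂ) (l : Fin (d + 1)) (y' : Site (d + 1)) :
    packSrc p (legSrcVec N M p C (Sum.inr l) y') =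
      pack 0 0 (fun κ => if κ = l then C * cphase (-quo N ((M : ℤ) • y')) p else 0) 0 := by
  unfold packSrc
  rw [srcEL_legSrcVec_inr, srcG_legSrcVec_inr, legSrcVec_inr_M, legSrcVec_inr_Q]

end Arrow

/-! ## §3 Scaled duality -/

section Duality

variable {ι : Type*} [Fintype ι]

/-- [folklore] **WEIGHTED CAUCHY–SCHWARZ**: `‖Σ_i w_i x_i‖² ≤ (Σ_i (σ_i‖w_i‖)²)·(Σ_i (‖x_i‖/σ_i)²)` for positive weights `σ`. -/
theorem norm_sum_mul_sq_le (w x : ι → ℂ) (σ : ι → ℝ) (hσ : ∀ i, 0 < σ i) :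
    ‖∑ i, w i * x i‖ ^ 2 ≤ (∑ i, (σ i * ‖w i‖) ^ 2) * ∑ i, (‖x i‖ / σ i) ^ 2 := by
  have h1 : ‖∑ i, w i * x i‖ ≤ ∑ i, (σ i * ‖w i‖) * (‖x i‖ / σ i) := by
    refine (norm_sum_le _ _).trans (le_of_eq (Finset.sum_congr rfl fun i _ => ?_))
    rw [norm_mul]
    field_simp [(hσ i).ne']
  have h0 : 0 ≤ ∑ i, (σ i * ‖w i‖) * (‖x i‖ / σ i) :=
    Finset.sum_nonneg fun i _ => mul_nonneg (mul_nonneg (hσ i).le (norm_nonneg _)) (div_nonneg (norm_nonneg _) (hσ i).le)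
  calc ‖∑ i, w i * x i‖ ^ 2 ≤ (∑ i, (σ i * ‖w i‖) * (‖x i‖ / σ i)) ^ 2 := pow_le_pow_left₀ (norm_nonneg _) h1 2
    _ ≤ (∑ i, (σ i * ‖w i‖) ^ 2) * ∑ i, (‖x i‖ / σ i) ^ 2 := Finset.sum_mul_sq_le_sq_mul_sq _ _ _

/-- [folklore] ONE TERM: `‖w · x_{i₀}‖² ≤ (σ_{i₀}‖w‖)² · Σ_i (‖x_i‖/σ_i)²`. -/
theorem norm_mul_apply_sq_le [DecidableEq ι] (w : ℂ) (x : ι → ℂ) (σ : ι → ℝ) (hσ : ∀ i, 0 < σ i) (i₀ : ι) :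
    ‖w * x i₀‖ ^ 2 ≤ (σ i₀ * ‖w‖) ^ 2 * ∑ i, (‖x i‖ / σ i) ^ 2 := by
  have h1 : (‖x i₀‖ / σ i₀) ^ 2 ≤ ∑ i, (‖x i‖ / σ i) ^ 2 :=
    Finset.single_le_sum (f := fun i => (‖x i‖ / σ i) ^ 2) (fun i _ => sq_nonneg _) (Finset.mem_univ i₀)
  have h2 : ‖w * x i₀‖ ^ 2 = (σ i₀ * ‖w‖) ^ 2 * (‖x i₀‖ / σ i₀) ^ 2 := by
    rw [norm_mul]
    field_simp [(hσ i₀).ne']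
  rw [h2]
  exact mul_le_mul_of_nonneg_left h1 (sq_nonneg _)

/-- [folklore] **FROM F7's CURRENCY TO THE SQUARED A-PRIORI FORM**: if the scaled matrix `S = D_ρ · 𝔸 · D_σ` (`D` = `Matrix.diagonal` of real weights,
`σ_i ≠ 0`) is invertible with `‖S⁻¹‖ ≤ A` in the Euclidean operator norm, then `Σ_i (‖x_i‖/σ_i)² ≤ A²·Σ_i (ρ_i‖(𝔸 x)_i‖)²` for every `x`. -/
theorem apriori_sq_of_scaled_inv [DecidableEq ι] (𝔸 : Matrix ι ι ℂ) (σ ρ : ι → ℝ) (hσ : ∀ i, σ i ≠ 0) {A : ℝ}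
    (hS : IsUnit (Matrix.diagonal (fun i => (ρ i : ℂ)) * 𝔸 * Matrix.diagonal (fun i => (σ i : ℂ))))
    (hA : ‖(Matrix.diagonal (fun i => (ρ i : ℂ)) * 𝔸 * Matrix.diagonal (fun i => (σ i : ℂ)))⁻¹‖ ≤ A) (x : ι → ℂ) :
    ∑ i, (‖x i‖ / σ i) ^ 2 ≤ A ^ 2 * ∑ i, (ρ i * ‖(𝔸 *ᵥ x) i‖) ^ 2 := by
  set S := Matrix.diagonal (fun i => (ρ i : ℂ)) * 𝔸 * Matrix.diagonal (fun i => (σ i : ℂ)) with hSdef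
  set y : ι → ℂ := fun i => x i / (σ i : ℂ) with hy
  have hσy : (Matrix.diagonal (fun i => (σ i : ℂ))) *ᵥ y = x := by
    funext i
    rw [Matrix.mulVec_diagonal, hy]
    have : (σ i : ℂ) ≠ 0 := by exact_mod_cast hσ i
    field_simp
  have hSy : S *ᵥ y = fun i => (ρ i : ℂ) * (𝔸 *ᵥ x) i := by
    rw [hSdef, ← Matrix.mulVec_mulVec, ← Matrix.mulVec_mulVec, hσy]
    funext i
    rw [Matrix.mulVec_diagonal]
  have hdet : IsUnit S.det := (Matrix.isUnit_iff_isUnit_det _).1 hS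
  have hyS : y = S⁻¹ *ᵥ (S *ᵥ y) := by rw [Matrix.mulVec_mulVec, Matrix.nonsing_inv_mul _ hdet, Matrix.one_mulVec]
  -- Euclidean norms
  have hnorm : ‖(WithLp.toLp 2 y : EuclideanSpace ℂ ι)‖ ≤ A * ‖(WithLp.toLp 2 (S *ᵥ y) : EuclideanSpace ℂ ι)‖ := by
    calc ‖(WithLp.toLp 2 y : EuclideanSpace ℂ ι)‖ = ‖(WithLp.toLp 2 (S⁻¹ *ᵥ (S *ᵥ y)) : EuclideanSpace ℂ ι)‖ := by rw [← hyS]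
      _ ≤ ‖S⁻¹‖ * ‖(WithLp.toLp 2 (S *ᵥ y) : EuclideanSpace ℂ ι)‖ := norm_toLp_mulVec_le _ _
      _ ≤ A * ‖(WithLp.toLp 2 (S *ᵥ y) : EuclideanSpace ℂ ι)‖ := mul_le_mul_of_nonneg_right hA (norm_nonneg _)
  have hsq := pow_le_pow_left₀ (norm_nonneg _) hnorm 2
  rw [mul_pow, EuclideanSpace.norm_sq_eq, EuclideanSpace.norm_sq_eq] at hsq
  have hl : ∑ i, (‖x i‖ / σ i) ^ 2 = ∑ i, ‖(WithLp.toLp 2 y : EuclideanSpace ℂ ι) i‖ ^ 2 := by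
    refine Finset.sum_congr rfl fun i _ => ?_
    rw [PiLp.toLp_apply, hy]
    simp only [norm_div, Complex.norm_real, Real.norm_eq_abs, div_pow, sq_abs]
  have hr : ∑ i, ‖(WithLp.toLp 2 (S *ᵥ y) : EuclideanSpace ℂ ι) i‖ ^ 2 = ∑ i, (ρ i * ‖(𝔸 *ᵥ x) i‖) ^ 2 := by
    refine Finset.sum_congr rfl fun i _ => ?_
    rw [PiLp.toLp_apply, hSy]
    simp only [norm_mul, Complex.norm_real, Real.norm_eq_abs]
    rw [mul_pow, mul_pow, sq_abs]
  rw [hl, ← hr]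
  exact hsq

end Duality

/-! ## §4 The four leg bounds as functions of the scaled a-priori bound -/

section Legs

variable (p : Fin (d + 1) → ℂ) {η : ℝ} {M : ℕ} {sf sm : ℝ}
variable (σ ρ : AIdx (d + 1) (TorusSite (d + 1) N) → ℝ) {A Sφ R0 RE RQ : ℝ}

/-- [folklore] A nonnegative function summed over the A-slots of one direction is at most its full sum over the arrow index. -/
theorem sum_aSlot_le (f : AIdx (d + 1) (TorusSite (d + 1) N) → ℝ) (hf : ∀ i, 0 ≤ f i) (κ : Fin (d + 1)) :
    ∑ m : TorusSite (d + 1) N, f (Sum.inl (Sum.inl κ, m)) ≤ ∑ i, f i := by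
  rw [Fintype.sum_sum_type, Fintype.sum_prod_type]
  have h1 : ∑ m : TorusSite (d + 1) N, f (Sum.inl (Sum.inl κ, m)) ≤ ∑ s : Loc (d + 1), ∑ m : TorusSite (d + 1) N, f (Sum.inl (s, m)) :=
    Finset.single_le_sum (f := fun s : Loc (d + 1) => ∑ m : TorusSite (d + 1) N, f (Sum.inl (s, m)))
      (fun s _ => Finset.sum_nonneg fun m _ => hf _) (Finset.mem_univ (Sum.inl κ))
  have h2 : 0 ≤ ∑ s : Loc (d + 1), f (Sum.inr s) := Finset.sum_nonneg fun s _ => hf _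
  linarith

/-- [folklore] The scaled a-priori bound at the arrow solution gives a trivial kernel. -/
theorem arrow_injective_of_apriori (hσ : ∀ i, 0 < σ i)
    (hAP : ∀ x, ∑ i, (‖x i‖ / σ i) ^ 2 ≤ A ^ 2 * ∑ i, (ρ i * ‖(arrowMat (aliasArrow N p) *ᵥ x) i‖) ^ 2) :
    ∀ x, arrowMat (aliasArrow N p) *ᵥ x = 0 → x = 0 := by
  intro x hx
  have h := hAP x
  rw [hx] at h
  simp only [Pi.zero_apply, norm_zero, mul_zero, ne_eq, OfNat.ofNat_ne_zero, not_false_eq_true, zero_pow, Finset.sum_const_zero,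
    mul_zero] at h
  have h0 : ∀ i, (‖x i‖ / σ i) ^ 2 = 0 := fun i =>
    le_antisymm ((Finset.single_le_sum (f := fun i => (‖x i‖ / σ i) ^ 2) (fun i _ => sq_nonneg _) (Finset.mem_univ i)).trans h) (sq_nonneg _)
  funext i
  have := h0 i
  rw [sq_eq_zero_iff, div_eq_zero_iff] at this
  rcases this with h1 | h1
  · exact norm_eq_zero.1 h1
  · exact absurd h1 (hσ i).ne'

/-- [folklore] THE ρ-WEIGHTED SOURCE NORM OF A FIELD LEG: `Σ_i (ρ_i‖(pack (sf•fhatF) 0 0 0)_i‖)² = sf²·Σ_m ρ(EL(m,l))²·‖srcW_T00(m)‖²`. -/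
theorem sum_packSrc_inl_eq (l : Fin (d + 1)) (y' : Site (d + 1)) :
    ∑ i, (ρ i * ‖pack (D := d + 1) (ι := TorusSite (d + 1) N) (fieldLegSrc N M p (legCoef M sf sm (Sum.inl l : Fib d)) l y') 0 0 0 i‖) ^ 2 =
      sf ^ 2 * ∑ m : TorusSite (d + 1) N, ρ (Sum.inl (Sum.inl l, m)) ^ 2 * ‖AliasObjects.srcW N M p m l y'‖ ^ 2 := by
  rw [fieldLegSrc_eq_smul_fhatF]
  simp only [Fintype.sum_sum_type, Fintype.sum_prod_type, pack, Sum.elim_inl, Sum.elim_inr, Pi.zero_apply, norm_zero, mul_zero,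
    ne_eq, OfNat.ofNat_ne_zero, not_false_eq_true, zero_pow, Finset.sum_const_zero, add_zero, Pi.smul_apply, smul_eq_mul]
  rw [Finset.sum_comm, Finset.mul_sum]
  refine Finset.sum_congr rfl fun m _ => ?_
  simp only [fhatF, mul_ite, mul_zero]
  rw [Finset.sum_eq_single l (fun κ _ hκ => by rw [if_neg hκ]; simp) (fun h => absurd (Finset.mem_univ _) h), if_pos rfl, norm_mul,
    Complex.norm_real, Real.norm_eq_abs, mul_pow, mul_pow, sq_abs]
  ring

/-- [folklore] THE ρ-WEIGHTED SOURCE NORM OF A MULTIPLIER LEG: `Σ_i (ρ_i‖(pack 0 0 q 0)_i‖)² = (ρ(Q_l)·‖C·cphase‖)²`. -/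
theorem sum_packSrc_inr_eq (C : ℂ) (l : Fin (d + 1)) (y' : Site (d + 1)) :
    ∑ i, (ρ i * ‖pack (D := d + 1) (ι := TorusSite (d + 1) N) 0 0 (fun κ => if κ = l then C * cphase (-quo N ((M : ℤ) • y')) p else 0) 0 i‖) ^ 2 =
      (ρ (Sum.inr (Sum.inl l)) * ‖C * cphase (-quo N ((M : ℤ) • y')) p‖) ^ 2 := by
  simp only [Fintype.sum_sum_type, Fintype.sum_prod_type, pack, Sum.elim_inl, Sum.elim_inr, Pi.zero_apply, norm_zero, mul_zero,
    ne_eq, OfNat.ofNat_ne_zero, not_false_eq_true, zero_pow, Finset.sum_const_zero, zero_add, add_zero, Finset.univ_unique]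
  rw [Finset.sum_eq_single l]
  · rw [if_pos rfl]
  · intro κ _ hκ; rw [if_neg hκ]; simp
  · intro h; exact absurd (Finset.mem_univ _) h

variable {p σ ρ}

/-- [folklore] **FIELD READING × ARROW SOLUTION** (the common step of ff / fm): under the a-priori bound, with `σ ≤ 1` on the A-slots,
`‖kFibW … (inl κ) x′ b y′ p‖² ≤ (sf²·Σ_m ‖readW_T00‖²) · A² · Σ_i (ρ_i‖(packSrc p legSrcVec)_i‖)²`. -/
theorem norm_kFibW_inl_sq_le (hσ : ∀ i, 0 < σ i) (hσA : ∀ m κ, σ (Sum.inl (Sum.inl κ, m)) ≤ 1)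
    (hAP : ∀ x, ∑ i, (‖x i‖ / σ i) ^ 2 ≤ A ^ 2 * ∑ i, (ρ i * ‖(arrowMat (aliasArrow N p) *ᵥ x) i‖) ^ 2)
    (κ : Fin (d + 1)) (x' : Site (d + 1)) (b : Fib d) (y' : Site (d + 1)) :
    ‖kFibW N M sf sm (Sum.inl κ) x' b y' p‖ ^ 2 ≤
      (sf ^ 2 * ∑ m : TorusSite (d + 1) N, ‖AliasObjects.readW N M p m κ x'‖ ^ 2) *
        (A ^ 2 * ∑ i, (ρ i * ‖packSrc p (legSrcVec N M p (legCoef M sf sm b) b y') i‖) ^ 2) := by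
  obtain ⟨c, hc⟩ := exists_arrow_eq p (arrow_injective_of_apriori p σ ρ hσ hAP) M (legCoef M sf sm b) b y'
  set v := solVec N M p (legCoef M sf sm b) b y' with hv
  set xx := pack (ampA p v) (ampμ p v) (fun κ => v (Sum.inr (Sum.inr κ))) c with hxx
  have hread := kFibW_inl_eq (N := N) M sf sm κ x' b y' p
  rw [← hv] at hread
  rw [hread]
  -- Cauchy–Schwarz with the A-slot weights
  have hCS := norm_sum_mul_sq_le (fun m => (sf : ℂ) * AliasObjects.readW N M p m κ x') (fun m => ampA p v m κ)
    (fun m => σ (Sum.inl (Sum.inl κ, m))) (fun m => hσ _)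
  refine hCS.trans ?_
  have hw : ∑ m : TorusSite (d + 1) N, (σ (Sum.inl (Sum.inl κ, m)) * ‖(sf : ℂ) * AliasObjects.readW N M p m κ x'‖) ^ 2 ≤
      sf ^ 2 * ∑ m : TorusSite (d + 1) N, ‖AliasObjects.readW N M p m κ x'‖ ^ 2 := by
    rw [Finset.mul_sum]
    refine Finset.sum_le_sum fun m _ => ?_
    rw [norm_mul, Complex.norm_real, Real.norm_eq_abs, mul_pow, mul_pow, sq_abs]
    have h1 : σ (Sum.inl (Sum.inl κ, m)) ^ 2 ≤ 1 := by
      have := hσA m κ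
      have h0 := (hσ (Sum.inl (Sum.inl κ, m))).le
      nlinarith
    nlinarith [sq_nonneg sf, sq_nonneg ‖AliasObjects.readW N M p m κ x'‖, mul_nonneg (sq_nonneg sf) (sq_nonneg ‖AliasObjects.readW N M p m κ x'‖)]
  have hx : ∑ m : TorusSite (d + 1) N, (‖ampA p v m κ‖ / σ (Sum.inl (Sum.inl κ, m))) ^ 2 ≤
      A ^ 2 * ∑ i, (ρ i * ‖packSrc p (legSrcVec N M p (legCoef M sf sm b) b y') i‖) ^ 2 := by
    have hsub := sum_aSlot_le (N := N) (fun i => (‖xx i‖ / σ i) ^ 2) (fun i => sq_nonneg _) κ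
    have hxxA : ∀ m, xx (Sum.inl (Sum.inl κ, m)) = ampA p v m κ := fun m => rfl
    simp only [hxxA] at hsub
    refine hsub.trans ?_
    rw [← hc]
    exact hAP xx
  exact mul_le_mul hw hx (Finset.sum_nonneg fun m _ => sq_nonneg _) (mul_nonneg (sq_nonneg _) (Finset.sum_nonneg fun _ _ => sq_nonneg _))

/-- [folklore] **MULTIPLIER READING × ARROW SOLUTION** (the common step of mf / mm): with `σ ≤ Sφ` on the φ-slots,
`‖kFibW … (inr κ) x′ b y′ p‖² ≤ (Sφ·sm·‖cphase(quo N (M•x′)) p‖)² · A² · Σ_i (ρ_i‖(packSrc p legSrcVec)_i‖)²`. -/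
theorem norm_kFibW_inr_sq_le (hσ : ∀ i, 0 < σ i) (hσφ : ∀ κ, σ (Sum.inr (Sum.inl κ)) ≤ Sφ) (hsm : 0 ≤ sm)
    (hAP : ∀ x, ∑ i, (‖x i‖ / σ i) ^ 2 ≤ A ^ 2 * ∑ i, (ρ i * ‖(arrowMat (aliasArrow N p) *ᵥ x) i‖) ^ 2)
    (κ : Fin (d + 1)) (x' : Site (d + 1)) (b : Fib d) (y' : Site (d + 1)) :
    ‖kFibW N M sf sm (Sum.inr κ) x' b y' p‖ ^ 2 ≤
      (Sφ * sm * ‖cphase (quo N ((M : ℤ) • x')) p‖) ^ 2 *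
        (A ^ 2 * ∑ i, (ρ i * ‖packSrc p (legSrcVec N M p (legCoef M sf sm b) b y') i‖) ^ 2) := by
  obtain ⟨c, hc⟩ := exists_arrow_eq p (arrow_injective_of_apriori p σ ρ hσ hAP) M (legCoef M sf sm b) b y'
  set v := solVec N M p (legCoef M sf sm b) b y' with hv
  set xx := pack (ampA p v) (ampμ p v) (fun κ => v (Sum.inr (Sum.inr κ))) c with hxx
  have hread := kFibW_inr_eq (N := N) M sf sm κ x' b y' p
  rw [← hv] at hread
  rw [hread]
  have hxxφ : xx (Sum.inr (Sum.inl κ)) = v (Sum.inr (Sum.inr κ)) := rfl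
  have h1 := norm_mul_apply_sq_le ((sm : ℂ) * cphase (quo N ((M : ℤ) • x')) p) xx σ hσ (Sum.inr (Sum.inl κ))
  rw [hxxφ] at h1
  refine h1.trans ?_
  have hw : (σ (Sum.inr (Sum.inl κ)) * ‖(sm : ℂ) * cphase (quo N ((M : ℤ) • x')) p‖) ^ 2 ≤ (Sφ * sm * ‖cphase (quo N ((M : ℤ) • x')) p‖) ^ 2 := by
    rw [norm_mul, Complex.norm_real, Real.norm_eq_abs, abs_of_nonneg hsm, ← mul_assoc]
    exact pow_le_pow_left₀ (mul_nonneg (mul_nonneg (hσ _).le hsm) (norm_nonneg _))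
      (mul_le_mul_of_nonneg_right (mul_le_mul_of_nonneg_right (hσφ κ) hsm) (norm_nonneg _)) 2
  have hx : ∑ i, (‖xx i‖ / σ i) ^ 2 ≤ A ^ 2 * ∑ i, (ρ i * ‖packSrc p (legSrcVec N M p (legCoef M sf sm b) b y') i‖) ^ 2 := by
    rw [← hc]; exact hAP xx
  exact mul_le_mul hw hx (Finset.sum_nonneg fun _ _ => sq_nonneg _) (sq_nonneg _)

/-- [folklore] THE FIELD SOURCE SUM under the row-weight bounds `|ρ(EL(0,l))| ≤ R0`, `|ρ(EL(m,l))| ≤ RE` (`m ≠ 0`), on the strip: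
`Σ_i (ρ_i‖(packSrc p (legSrcVec … (inl l) …))_i‖)² ≤ sf²·N^{−2D}·e(y′)²·6^{D+1}(N/M)^{2D}·(R0² + RE²(5^D−1))`. -/
theorem sum_packSrc_inl_le (him : ∀ i, |(p i).im| ≤ η) (hre : ∀ i, |(p i).re| ≤ π) (hη : 0 ≤ η) (hη4 : η ≤ 1 / 4)
    (hM : 0 < M) (hMN : M ≤ N) (l : Fin (d + 1)) (y' : Site (d + 1))
    (hρ0 : |ρ (Sum.inl (Sum.inl l, 0))| ≤ R0) (hρE : ∀ m, m ≠ 0 → |ρ (Sum.inl (Sum.inl l, m))| ≤ RE) :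
    ∑ i, (ρ i * ‖packSrc p (legSrcVec N M p (legCoef M sf sm (Sum.inl l : Fib d)) (Sum.inl l) y') i‖) ^ 2 ≤
      sf ^ 2 * ((((N : ℝ) ^ (d + 1)) ^ 2)⁻¹ *
        (Real.exp (η * ∑ i, |(y' i : ℝ)|) ^ 2 * ((6 : ℝ) ^ (d + 1 + 1) * (((N : ℝ) / M) ^ 2) ^ (d + 1)) * (R0 ^ 2 + RE ^ 2 * ((5 : ℝ) ^ (d + 1) - 1)))) := by
  rw [packSrc_legSrcVec_inl, sum_packSrc_inl_eq]
  refine mul_le_mul_of_nonneg_left ?_ (sq_nonneg _)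
  have hN : (0 : ℝ) < (N : ℝ) ^ (d + 1) := pow_pos (by exact_mod_cast Nat.pos_of_ne_zero (NeZero.ne N)) _
  -- pass to the `N^D · srcW` currency of part 1 with the weights `w m = |ρ (EL(m,l))|`
  have hsum := sum_weighted_norm_srcW_sq_le_strip (D := d + 1) him hre hη hη4 hM hMN l y' (fun m => |ρ (Sum.inl (Sum.inl l, m))|)
    (fun m hm => ⟨abs_nonneg _, hρE m hm⟩)
  have hrew : ∀ m : TorusSite (d + 1) N, ρ (Sum.inl (Sum.inl l, m)) ^ 2 * ‖AliasObjects.srcW N M p m l y'‖ ^ 2 =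
      (((N : ℝ) ^ (d + 1)) ^ 2)⁻¹ * (|ρ (Sum.inl (Sum.inl l, m))| ^ 2 * ‖(N : ℂ) ^ (d + 1) * AliasObjects.srcW N M p m l y'‖ ^ 2) := by
    intro m
    rw [norm_mul, norm_pow, Complex.norm_natCast, mul_pow, sq_abs]
    field_simp
  rw [Finset.sum_congr rfl fun m _ => hrew m, ← Finset.mul_sum]
  refine mul_le_mul_of_nonneg_left (hsum.trans ?_) (by positivity)
  have h0 : |ρ (Sum.inl (Sum.inl l, 0))| ^ 2 ≤ R0 ^ 2 := pow_le_pow_left₀ (abs_nonneg _) hρ0 2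
  have h5 : (0 : ℝ) ≤ (5 : ℝ) ^ (d + 1) - 1 := by
    have : (1 : ℝ) ≤ (5 : ℝ) ^ (d + 1) := one_le_pow₀ (by norm_num)
    linarith
  gcongr

/-- [folklore] THE MULTIPLIER SOURCE SUM under `|ρ(Q_l)| ≤ RQ`: `Σ_i (ρ_i‖(packSrc p (legSrcVec … (inr l) …))_i‖)² ≤ (RQ·sm·‖cphase(−quo N (M•y′)) p‖)²`. -/
theorem sum_packSrc_inr_le (hRQ : 0 ≤ RQ) (hsm : 0 ≤ sm) (l : Fin (d + 1)) (y' : Site (d + 1)) (hρQ : |ρ (Sum.inr (Sum.inl l))| ≤ RQ) :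
    ∑ i, (ρ i * ‖packSrc p (legSrcVec N M p (legCoef M sf sm (Sum.inr l : Fib d)) (Sum.inr l) y') i‖) ^ 2 ≤
      (RQ * sm * ‖cphase (-quo N ((M : ℤ) • y')) p‖) ^ 2 := by
  rw [packSrc_legSrcVec_inr, sum_packSrc_inr_eq]
  have hC : ‖legCoef M sf sm (Sum.inr l : Fib d) * cphase (-quo N ((M : ℤ) • y')) p‖ = sm * ‖cphase (-quo N ((M : ℤ) • y')) p‖ := by
    rw [norm_mul]
    simp [legCoef, legScale, legW, Complex.norm_real, abs_of_nonneg hsm]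
  have ht0 : 0 ≤ ‖cphase (-quo N ((M : ℤ) • y')) p‖ := norm_nonneg _
  rw [hC]
  refine sq_le_sq.2 ?_
  rw [abs_mul, abs_of_nonneg (mul_nonneg hsm ht0), abs_of_nonneg (mul_nonneg (mul_nonneg hRQ hsm) ht0), mul_assoc]
  exact mul_le_mul_of_nonneg_right hρQ (mul_nonneg hsm ht0)

end Legs

end Summit.QuantumFields.BalabanUV.Beta.GAN24.StripLegReadout

end
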